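import Mathlib.MeasureTheory.Integral.Lebesgue.Basic
import HarnessLib

/-!
# Crux `EnergyCurrentTails` (stmt-AtomisticToContinuum-9235), line `quartic-schur-ledger`:
# the absorbing one-window recursion (the bookkeeping glue of the quartic maximum principle)

This is §3 of the line lead's registered skeleton `Cruxes/EnergyCurrentTails/Lines/quartic_schur_ledger.lean`,
landed as a tree theorem so that the line's composition
`L + Q0 + S1 + S2 ⟹ uniform quartic moment ⟹ EnergyCurrentTails` (file
`…EnergyCurrentTailsSplit.lean`) can be stated over landed declarations only.

**Statement.**  Let `y ≥ 0` (a content, here: the expected empirical quartic velocity moment along the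
flow) and `G, L ≥ 0` (window gain and loss) satisfy the exact ledger `y s′ + L(s,s′) = y s + G(s,s′)`
(`0 ≤ s ≤ s′`), the LOSS FLOOR `c·y s ≤ c·A + L(s, s+h)` and the SUB-LINEAR GAIN
`G(s,s′) ≤ D + η·sup_{[s,s′]} y` (`s′ ≤ s + h`) for window starts `s ∈ [0,t]`, with `0 < c ≤ 1`,
`0 ≤ η ≤ c/4`, a crude a-priori bound `y ≤ B′` and the initial bound `y 0 ≤ B`.  Then
`y s ≤ 2 (max B (2A + 4D/c) + D)` for every `s ∈ [0,t]` — a bound in which neither the window `h`, nor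
the crude bound `B′`, nor the number of windows `t/h` appears (this is where the collision clock of the
hard-sphere gas cancels: `h = τ (N+1)^{-1/3}` while loss floor and gain ceiling both carry the factor
`σ²(N+1)^{1/3} h`).

**Proof.**  Everything is finite (`y ≤ B′`), so pass to real numbers.  (1) Inside one window the ledger
and the gain ceiling give `sup_{[s,s+h]} y ≤ y s + D + η sup`, whence `sup ≤ 2(y s + D)` (`η ≤ 1/4`).
(2) One step: `y(s+h) = y s + G − L ≤ y s + D + η sup − c y s + cA ≤ (1 − c/2) y s + cA + 2D`.
(3) Induction over the grid `kh ≤ t`: `y(kh) ≤ K₁ := max B (2A + 4D/c)` (the affine map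
`x ↦ (1 − c/2)x + cA + 2D` preserves `[0, K₁]`).  (4) Every `s ∈ [0,t]` lies in the window of
`⌊s/h⌋h ≤ t`, so `y s ≤ sup ≤ 2(K₁ + D)`.

References: the maximum-principle bookkeeping is elementary; its role model is the ODE comparison
behind moment bounds for the homogeneous Boltzmann equation (Bobylev 1997; Mischler–Wennberg 1999).
-/

noncomputable section

open Set
open scoped ENNReal

namespace Summit.AtomisticToContinuum.HydrodynamicLimit.Theorems.QuarticSchurLedger

/-- **The absorbing one-window recursion** (line `quartic-schur-ledger`, crux `EnergyCurrentTails`,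
stmt-AtomisticToContinuum-9235; skeleton §3).  Let `y ≥ 0` and `G, L ≥ 0` satisfy the exact ledger
`y s′ + L(s,s′) = y s + G(s,s′)` (`0 ≤ s ≤ s′`), the loss floor `c·y s ≤ c·A + L(s, s+h)` and the
sub-linear gain `G(s,s′) ≤ D + η·sup_{[s,s′]} y` (`s′ ≤ s + h`) for window starts `s ∈ [0,t]`, with
`0 < c ≤ 1`, `0 ≤ η ≤ c/4`, a crude bound `y ≤ B′` and `y 0 ≤ B`.  Then `y s ≤ 2 (max B (2A + 4D/c) + D)`
for every `s ∈ [0,t]`.  Steps: `sup_{[s,s+h]} y ≤ 2(y s + D)`; `y(s+h) ≤ (1 − c/2) y s + cA + 2D`;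
induction over `kh ≤ t`; every `s ≤ t` lies in the window of `⌊s/h⌋h`. [folklore] -/
theorem absorbing_recursion : ∀ {y : ℝ → ℝ≥0∞} {G L : ℝ → ℝ → ℝ≥0∞} {t h c A D η B B' : ℝ}, 0 < h → 0 < c → c ≤ 1 → 0 ≤ A → 0 ≤ D → 0 ≤ η → η ≤ c / 4 → 0 ≤ B → (∀ r, y r ≤ ENNReal.ofReal B') → y 0 ≤ ENNReal.ofReal B → (∀ s s', 0 ≤ s → s ≤ s' → y s' + L s s' = y s + G s s') → (∀ s ∈ Set.Icc 0 t, ENNReal.ofReal c * y s ≤ ENNReal.ofReal (c * A) + L s (s + h)) → (∀ s ∈ Set.Icc 0 t, ∀ s' ∈ Set.Icc s (s + h), G s s' ≤ ENNReal.ofReal D + ENNReal.ofReal η * ⨆ r ∈ Set.Icc s s', y r) → ∀ s ∈ Set.Icc 0 t, y s ≤ ENNReal.ofReal (2 * (max B (2 * A + 4 * D / c) + D)) := by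
  intro y G L t h c A D η B B' hh hc hc1 hA hD hη hηc hB hbdd h0 hled hloss hgain
  -- Step 0: finiteness and the real-valued copies.
  set B'' : ℝ := max B' 0 with hB''
  have hbdd' : ∀ r, y r ≤ ENNReal.ofReal B'' := fun r =>
    (hbdd r).trans (ENNReal.ofReal_le_ofReal (le_max_left _ _))
  have hy_ne : ∀ r, y r ≠ ⊤ := fun r => ne_top_of_le_ne_top ENNReal.ofReal_ne_top (hbdd' r)
  set yR : ℝ → ℝ := fun r => (y r).toReal with hyR
  have hy_eq : ∀ r, y r = ENNReal.ofReal (yR r) := fun r => (ENNReal.ofReal_toReal (hy_ne r)).symm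
  have hyR_nn : ∀ r, 0 ≤ yR r := fun r => ENNReal.toReal_nonneg
  -- window suprema
  set S : ℝ → ℝ≥0∞ := fun s => ⨆ r ∈ Icc s (s + h), y r with hS
  have hS_le : ∀ s, S s ≤ ENNReal.ofReal B'' := fun s => iSup₂_le fun r _ => hbdd' r
  have hS_ne : ∀ s, S s ≠ ⊤ := fun s => ne_top_of_le_ne_top ENNReal.ofReal_ne_top (hS_le s)
  have hy_le_S : ∀ s, ∀ r ∈ Icc s (s + h), y r ≤ S s := fun s r hr =>
    le_iSup₂ (f := fun r (_ : r ∈ Icc s (s + h)) => y r) r hr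
  set SR : ℝ → ℝ := fun s => (S s).toReal with hSR
  have hSR_nn : ∀ s, 0 ≤ SR s := fun s => ENNReal.toReal_nonneg
  have hyR_le_SR : ∀ s, ∀ r ∈ Icc s (s + h), yR r ≤ SR s := fun s r hr =>
    (ENNReal.toReal_le_toReal (hy_ne r) (hS_ne s)).2 (hy_le_S s r hr)
  -- gain: finite, and its real form
  have hG_le : ∀ s ∈ Icc 0 t, ∀ s' ∈ Icc s (s + h),
      G s s' ≤ ENNReal.ofReal D + ENNReal.ofReal η * S s := by
    intro s hs s' hs'
    refine (hgain s hs s' hs').trans ?_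
    gcongr
    exact biSup_mono fun r hr => ⟨hr.1, hr.2.trans hs'.2⟩
  have hG_ne : ∀ s ∈ Icc 0 t, ∀ s' ∈ Icc s (s + h), G s s' ≠ ⊤ := by
    intro s hs s' hs'
    refine ne_top_of_le_ne_top ?_ (hG_le s hs s' hs')
    exact ENNReal.add_ne_top.2 ⟨ENNReal.ofReal_ne_top, ENNReal.mul_ne_top ENNReal.ofReal_ne_top (hS_ne s)⟩
  have hGR : ∀ s ∈ Icc 0 t, ∀ s' ∈ Icc s (s + h), (G s s').toReal ≤ D + η * SR s := by
    intro s hs s' hs'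
    have h1 := (ENNReal.toReal_le_toReal (hG_ne s hs s' hs')
      (ENNReal.add_ne_top.2 ⟨ENNReal.ofReal_ne_top,
        ENNReal.mul_ne_top ENNReal.ofReal_ne_top (hS_ne s)⟩)).2 (hG_le s hs s' hs')
    rwa [ENNReal.toReal_add ENNReal.ofReal_ne_top (ENNReal.mul_ne_top ENNReal.ofReal_ne_top (hS_ne s)),
      ENNReal.toReal_mul, ENNReal.toReal_ofReal hD, ENNReal.toReal_ofReal hη] at h1
  -- loss: finite, and the real ledger
  have hL_le : ∀ s s', 0 ≤ s → s ≤ s' → L s s' ≤ y s + G s s' := by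
    intro s s' hs0 hss'
    calc L s s' ≤ y s' + L s s' := le_add_self
      _ = y s + G s s' := hled s s' hs0 hss'
  have hL_ne : ∀ s ∈ Icc 0 t, ∀ s' ∈ Icc s (s + h), L s s' ≠ ⊤ := by
    intro s hs s' hs'
    refine ne_top_of_le_ne_top ?_ (hL_le s s' hs.1 hs'.1)
    exact ENNReal.add_ne_top.2 ⟨hy_ne s, hG_ne s hs s' hs'⟩
  have hledR : ∀ s ∈ Icc 0 t, ∀ s' ∈ Icc s (s + h),
      yR s' + (L s s').toReal = yR s + (G s s').toReal := by
    intro s hs s' hs'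
    have h1 := congrArg ENNReal.toReal (hled s s' hs.1 hs'.1)
    rwa [ENNReal.toReal_add (hy_ne s') (hL_ne s hs s' hs'),
      ENNReal.toReal_add (hy_ne s) (hG_ne s hs s' hs')] at h1
  -- loss floor, real form
  have hsh : ∀ s : ℝ, s + h ∈ Icc s (s + h) := fun s => ⟨le_add_of_nonneg_right hh.le, le_rfl⟩
  have hlossR : ∀ s ∈ Icc 0 t, c * yR s ≤ c * A + (L s (s + h)).toReal := by
    intro s hs
    have hne : ENNReal.ofReal (c * A) + L s (s + h) ≠ ⊤ :=
      ENNReal.add_ne_top.2 ⟨ENNReal.ofReal_ne_top, hL_ne s hs (s + h) (hsh s)⟩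
    have h1 := (ENNReal.toReal_le_toReal
      (ENNReal.mul_ne_top ENNReal.ofReal_ne_top (hy_ne s)) hne).2 (hloss s hs)
    rwa [ENNReal.toReal_mul, ENNReal.toReal_ofReal hc.le,
      ENNReal.toReal_add ENNReal.ofReal_ne_top (hL_ne s hs (s + h) (hsh s)),
      ENNReal.toReal_ofReal (mul_nonneg hc.le hA)] at h1
  -- Step 1: inside one window the content is controlled by its value at the window start.
  have hwin : ∀ s ∈ Icc 0 t, ∀ r ∈ Icc s (s + h), yR r ≤ yR s + D + η * SR s := by
    intro s hs r hr
    have h1 := hledR s hs r hr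
    have h2 := hGR s hs r hr
    have h3 : 0 ≤ (L s r).toReal := ENNReal.toReal_nonneg
    linarith
  have hSR_le : ∀ s ∈ Icc 0 t, SR s ≤ yR s + D + η * SR s := by
    intro s hs
    have hnn : 0 ≤ yR s + D + η * SR s := by
      have := hyR_nn s; have := hSR_nn s; positivity
    have h1 : S s ≤ ENNReal.ofReal (yR s + D + η * SR s) :=
      iSup₂_le fun r hr => by
        rw [hy_eq r]
        exact ENNReal.ofReal_le_ofReal (hwin s hs r hr)
    exact ENNReal.toReal_le_of_le_ofReal hnn h1
  have hη4 : η ≤ 1 / 4 := hηc.trans (by linarith)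
  have hSR_bound : ∀ s ∈ Icc 0 t, SR s ≤ 2 * (yR s + D) := by
    intro s hs
    have h1 := hSR_le s hs
    have h2 : η * SR s ≤ (1 / 4) * SR s := mul_le_mul_of_nonneg_right hη4 (hSR_nn s)
    have h3 := hyR_nn s
    nlinarith
  -- Step 2: one step of the recursion at a window start `s ∈ [0,t]`.
  have hstep : ∀ s ∈ Icc 0 t, yR (s + h) ≤ (1 - c / 2) * yR s + (c * A + 2 * D) := by
    intro s hs
    have h1 := hledR s hs (s + h) (hsh s)
    have h2 := hGR s hs (s + h) (hsh s)
    have h3 := hlossR s hs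
    have h4 := hSR_bound s hs
    have h5 : η * SR s ≤ (c / 4) * SR s := mul_le_mul_of_nonneg_right hηc (hSR_nn s)
    have h6 : (c / 4) * (2 * (yR s + D)) ≤ (c / 2) * yR s + D := by
      have := hyR_nn s
      nlinarith
    have h7 : (c / 4) * SR s ≤ (c / 4) * (2 * (yR s + D)) :=
      mul_le_mul_of_nonneg_left h4 (by linarith)
    nlinarith
  -- Step 3: induction over the window starts `k·h ≤ t`.
  set K₁ : ℝ := max B (2 * A + 4 * D / c) with hK₁
  have hK₁B : B ≤ K₁ := le_max_left _ _
  have hK₁_abs : c * A + 2 * D ≤ (c / 2) * K₁ := by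
    have h1 : (c / 2) * (2 * A + 4 * D / c) = c * A + 2 * D := by
      field_simp
      ring
    have h2 : (c / 2) * (2 * A + 4 * D / c) ≤ (c / 2) * K₁ :=
      mul_le_mul_of_nonneg_left (le_max_right _ _) (by linarith)
    linarith
  have hK₁_nn : 0 ≤ K₁ := hB.trans hK₁B
  have hgrid : ∀ k : ℕ, (k : ℝ) * h ≤ t → yR ((k : ℝ) * h) ≤ K₁ := by
    intro k
    induction k with
    | zero =>
      intro _
      have h1 : yR 0 ≤ B := ENNReal.toReal_le_of_le_ofReal hB h0
      simpa using h1.trans hK₁B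
    | succ k ih =>
      intro hk
      have hk' : ((k : ℝ) + 1) * h ≤ t := by push_cast at hk; exact hk
      have hkh : (k : ℝ) * h ≤ t := by nlinarith
      have hk0 : 0 ≤ (k : ℝ) * h := by positivity
      have h1 := ih hkh
      have h2 := hstep ((k : ℝ) * h) ⟨hk0, hkh⟩
      have h3 : ((k + 1 : ℕ) : ℝ) * h = (k : ℝ) * h + h := by push_cast; ring
      rw [h3]
      have h4 : (1 - c / 2) * yR ((k : ℝ) * h) ≤ (1 - c / 2) * K₁ :=
        mul_le_mul_of_nonneg_left h1 (by linarith)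
      linarith
  -- Step 4: every `s ∈ [0,t]` lies in the window of the grid point `⌊s/h⌋·h ≤ s`.
  intro s hs
  set k : ℕ := ⌊s / h⌋₊ with hk
  have hsk : (k : ℝ) ≤ s / h := Nat.floor_le (div_nonneg hs.1 hh.le)
  have hsk' : s / h < (k : ℝ) + 1 := Nat.lt_floor_add_one _
  have hk1 : (k : ℝ) * h ≤ s := by rwa [le_div_iff₀ hh] at hsk
  have hk2 : s ≤ (k : ℝ) * h + h := by
    rw [div_lt_iff₀ hh] at hsk'
    linarith
  have hkt : (k : ℝ) * h ≤ t := hk1.trans hs.2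
  have hk0 : 0 ≤ (k : ℝ) * h := by positivity
  have h1 : yR s ≤ SR ((k : ℝ) * h) := hyR_le_SR _ s ⟨hk1, hk2⟩
  have h2 := hSR_bound ((k : ℝ) * h) ⟨hk0, hkt⟩
  have h3 := hgrid k hkt
  rw [hy_eq s]
  apply ENNReal.ofReal_le_ofReal
  calc yR s ≤ 2 * (yR ((k : ℝ) * h) + D) := h1.trans h2
    _ ≤ 2 * (K₁ + D) := by linarith
    _ = 2 * (max B (2 * A + 4 * D / c) + D) := by rw [hK₁]

end Summit.AtomisticToContinuum.HydrodynamicLimit.Theorems.QuarticSchurLedger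

end
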